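import Literature.MathematicalPhysics.QuantumFieldTheory.Balaban1983to89.B3ScalarPropagatorWick
import Literature.MathematicalPhysics.QuantumFieldTheory.Balaban1983to89.HiggsFluctMeasureWickSum

/-!
# `Balaban1983to89.B3ScalarPropagatorWickSum` — T. Bałaban, *(Higgs)₂,₃ quantum fields in a finite volume. III.
Renormalization*, Commun. Math. Phys. **88** (1983) 411–445 [Balaban1983Higgs3], p. 414: **the `φ′`-legs «are again divided
into pairs and each pair is replaced by a propagator, i.e. by G_k(Ω, B̃), …» IN CLOSED FORM** for the Gaussian fluctuation `χ`
of the old field (`B3ScalarPropagatorMean.rt14_gaussian_eq`): against the weight `e^{−½⟨χ̃,G_k(Ω,B̃)^{−1}χ̃⟩}`,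
`∫ Π_{i∈s}⟨χ̃,f_i⟩ e^{…} dχ = wickSum (fun a b => ⟨f_b, G_k(Ω,B̃)f_a⟩) s · ∫ e^{…} dχ` (all legs supported in `Ω`), PROVED by
strong induction from `B3ScalarPropagatorWick.wick_recursion_chi` with the typer's pairing sum
`HiggsFluctMeasureWickSum.wickSum`; theorems only

statement-level skeleton of published theorems with citation tags; proofs where landed; nothing here is a claim about the Yang–Mills mass gap

PDF held: `paper:balaban1983-higgs-2-3-quantum-fields-finite-volume` (journal page = PDF page + 410).

CITATION HEADER (lean-in-tree rule).  lit-balaban typed skeleton (HOME `run/shared/lean/pub/lit-balaban/`), typer line,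
sequel of `B3ScalarPropagatorWick`; located member of the SKELETON rows **B3.Eq1.12-1.15** and **B3.Eq1.4** (owner r15;
cells only, zero head weight).  THE SOURCE TEXT, p. 414 [PDF 4], verbatim: *"Some φ′-legs are replaced by external scalar
fields and the remaining are again divided into pairs and each pair is replaced by a propagator, i.e. by G_k(Ω, B̃),
G_k(Ω₂, B̃), δG_k(Ω, Ω₂, B̃) or the operator (1.16)."*

WHAT IS PROVED (0 sorry; theorems only).  **`integral_prodExtLegs_eq_wickSum`** (the closed form, unnormalised: both sides
against the same weight; `msq > 0`, `a_k ≥ 0`, legs supported in `Ω = B^k(Ω^{(k)})`).  Unit `lit-balaban-typer` gen 30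
(literature-prover-lit-balaban-typer-g30-0); HOME/FILED.md records the proposal.
-/

open scoped BigOperators InnerProductSpace
open _root_.MeasureTheory

namespace Literature.MathematicalPhysics.QuantumFieldTheory.Balaban1983to89.B3ScalarPropagatorWickSum

open Literature.MathematicalPhysics.QuantumFieldTheory.Balaban1983to89.HiggsLattice
open Literature.MathematicalPhysics.QuantumFieldTheory.Balaban1983to89.HiggsCovariance
open Literature.MathematicalPhysics.QuantumFieldTheory.Balaban1983to89.HiggsCovariancePos
open Literature.MathematicalPhysics.QuantumFieldTheory.Balaban1983to89.B3Eq14AuxFunction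
open Literature.MathematicalPhysics.QuantumFieldTheory.Balaban1983to89.B3ScalarPropagatorMean
open Literature.MathematicalPhysics.QuantumFieldTheory.Balaban1983to89.B3ScalarPropagatorCovariance
open Literature.MathematicalPhysics.QuantumFieldTheory.Balaban1983to89.B3ScalarPropagatorWick
open Literature.MathematicalPhysics.QuantumFieldTheory.Balaban1983to89.HiggsFluctMeasureWickSum

variable {P : HiggsLattice.Params} {N : ℕ}

variable (C : ChargeData N) (A : HiggsLattice.VecField P 0) {k : ℕ} (Ωk : Finset (HiggsLattice.Site P k)) {msq : ℝ} (a : ℝ)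
  {ι : Type*} [LinearOrder ι]

/-- **WICK'S THEOREM FOR THE FLUCTUATION `χ` IN CLOSED FORM**: for legs `f_i` supported in `Ω`,
`∫ Π_{i∈s}⟨χ̃,f_i⟩ e^{−½⟨χ̃,G_k^{−1}χ̃⟩} dχ = wickSum (fun a b => ⟨f_b, G_k(Ω,B̃)f_a⟩) s · ∫ e^{−½⟨χ̃,G_k^{−1}χ̃⟩} dχ` — each pairing
contributes the product of the propagators `G_k(Ω,B̃)` of its pairs; `msq > 0`, `a_k ≥ 0`. PROVED (strong induction from
`wick_recursion_chi`). [cite: Balaban1983Higgs3, (1.4) p.414] -/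
theorem integral_prodExtLegs_eq_wickSum (hmsq : 0 < msq) (hak : 0 ≤ B1.aSeq a P.L k) {f : ι → ScalarField P 0 N}
    (hf : ∀ i x, x ∉ region k Ωk → f i x = 0) (s : Finset ι) :
    ∫ χ, (∏ i ∈ s, siteInner (extendZero (region k Ωk) χ) (f i))
        * Real.exp (-(1 / 2 : ℝ) * siteInner (extendZero (region k Ωk) χ)
            (covOpK C (region k Ωk) A msq a k (extendZero (region k Ωk) χ)))
      = wickSum (fun a' b' => siteInner (f b') (propagatorK C (region k Ωk) A msq a k (f a'))) s
        * ∫ χ, Real.exp (-(1 / 2 : ℝ) * siteInner (extendZero (region k Ωk) χ)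
            (covOpK C (region k Ωk) A msq a k (extendZero (region k Ωk) χ))) := by
  induction s using Finset.strongInduction with
  | H s ih =>
    by_cases h : s.Nonempty
    · have hm := Finset.min'_mem s h
      have hsplit : (fun χ : ↥(region k Ωk) → EuclideanSpace ℝ (Fin N) =>
            (∏ i ∈ s, siteInner (extendZero (region k Ωk) χ) (f i))
              * Real.exp (-(1 / 2 : ℝ) * siteInner (extendZero (region k Ωk) χ)
                  (covOpK C (region k Ωk) A msq a k (extendZero (region k Ωk) χ))))
          = fun χ => siteInner (extendZero (region k Ωk) χ) (f (s.min' h))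
              * (∏ i ∈ s.erase (s.min' h), siteInner (extendZero (region k Ωk) χ) (f i))
              * Real.exp (-(1 / 2 : ℝ) * siteInner (extendZero (region k Ωk) χ)
                  (covOpK C (region k Ωk) A msq a k (extendZero (region k Ωk) χ))) := by
        funext χ
        rw [← Finset.mul_prod_erase s (fun i => siteInner (extendZero (region k Ωk) χ) (f i)) hm]
      rw [hsplit, wick_recursion_chi C A Ωk a hmsq hak (s.erase (s.min' h)) f (hf (s.min' h)),
        wickSum_of_nonempty _ h, Finset.sum_mul]
      refine Finset.sum_congr rfl fun i hi => ?_
      rw [ih _ (lt_of_le_of_lt (Finset.erase_subset _ _) (Finset.erase_ssubset hm)), mul_assoc]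
    · rw [Finset.not_nonempty_iff_eq_empty.1 h, wickSum_empty, one_mul]
      simp

end Literature.MathematicalPhysics.QuantumFieldTheory.Balaban1983to89.B3ScalarPropagatorWickSum
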